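/-
Copyright (c) 2026 the pub-hodgecm-mathlib formalisation cell (harness21).  Prover seat hodgecm-mathlib-F0P3b-p01 (g26); E1 keeper ∕ dealer F0P3a-p03 (g31) k23∕k85
(E1 BRICK LEDGER row 68-H «K4′ SPLIT @ DATUM», DATUM HALF; SIGSHEET-68H v1 1a8eb138).
-/
import Summits.HodgeConjecture.HodgeConjecture.Theorems.F0P3cStCharTSAdditiveCharLine      -- ★ 68-R `additive_eq_mul_of_eq_zero_on_open` (the `hrank` sentence at the datum)
import Summits.HodgeConjecture.HodgeConjecture.Theorems.F0P3cStCharTSLdsSelfExtSplitAbs      -- ★-to-be 68-H abstract half (this seat): `forall_smooth_selfExtension_split_of_realisedPair`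
import Summits.HodgeConjecture.HodgeConjecture.Theorems.F0P3cStCharTSLdsRealisationBoth      -- ★-to-be 68-A DATUM (this seat) p853741: `exists_ldsRealisation_schurPair_of_mem`; brings ★ 64-B, N1∕N2∕N3-holds, `Gqs`
import Summits.HodgeConjecture.HodgeConjecture.Theorems.F0P3cStCharTSHeightOracleAtDatum      -- ★ 40‴β p853390: `exists_height_of_occurring`, `additive_eq_zero_on_level_of_occurring`, `isCompact_torus_inf_level_cmBorel`
import Summits.HodgeConjecture.HodgeConjecture.Theorems.F0P3UnipotentLimitCompactOpen          -- ★ `isLimitOfCompactOpen_cmUnipotentU`; brings ★ `deltaChar_cmBorel_eq_one`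
import Literature.RepresentationTheory.SelfExtensionSplittingEquiv                             -- ★ 63-D p853617: `forall_smooth_selfExtension_split_of_equiv`
import Literature.NumberTheory.Automorphic.LocalUnitaryIntegralLevel                           -- ★ `isCompact_isOpen_cmLocalIntegralLevel`
import HarnessLib

/-!
# F0 · P3c · «StCharTS» K4′ column — E1 row 68-H (DATUM HALF) «K4′ SPLIT @ DATUM»: every smooth self-extension of (a representative of) EITHER member of the l.d.s. packet
# `Π(θ) = JH(i_B(θ̃))` of `U(Φ₃)(L⁺_v)` SPLITS — modulo the open-cell jet datum (M5), carried as the binder `hGLd`, and `htwo` (rung 0's `hLdsRedTwo`); the additive line is ★ 68-R by import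
# [Rogawski1990, §12.2 (3) pp. 173–174; Keys1984 §3–§4; Casselman1995 §7.1]

Cell `pub/hodgecm-mathlib`, crux H413 = `stmt-HodgeConjecture-24833` (`--supports` lane, `--as helper`-class: THEOREMS ONLY).  Namespace
`Summit.HodgeConjecture.HodgeConjecture.Cruxes.H413.F0P3cStCharTSLdsSelfExtSplit`.  E1 BRICK LEDGER (keeper F0P3a-p03 (g31)) row 68-H, datum half = ONE application of ★ 68-H
abstract `F0P3cStCharTSLdsSelfExtSplitAbs.forall_smooth_selfExtension_split_of_realisedPair` at `t := cmBorelTriple L 3 v`, `χ₁ := 𝟙 ⊗ θ̃`, over ★ 68-A DATUM ×2 (both members as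
subs), ★ N1-holds (`dim r_B I₀ = 2`), ★ N3-holds, ★ `isAdmissible_cmPrincipalSeries`, ★ `exists_isOpen_isCompact_subgroup_cmLocal`, ★ 40‴β ((H) and the open kernel `T ∩ K_v` of an
occurring character), then ★ 63-D transport to the representative `r`.  The conclusion is ★ 59 trunk's `hsplit` binder VERBATIM at `r` (consumers: 68-I ∕ 68-I-NW via ★ row 73).
HONEST LABEL: count-neutral datum helper; non-★ binders: `hGLd` ((M5), (O1)-D ED. 2 over (O2) FILE B), `htwo` (= rung 0's (R1)+(R2)); `hrank` is ★ 68-R `additive_eq_mul_of_eq_zero_on_open` by name; h413 OPEN; HC_CM is proved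
only modulo the 7 printed citations (2 remaining named inputs hLiu418 = stmt-HodgeConjecture-24832, h413 = stmt-HodgeConjecture-24833) until rung 0 closes.
-/

set_option autoImplicit false
set_option linter.dupNamespace false

noncomputable section

open NumberField IsDedekindDomain Function
open scoped Matrix
open Literature.NumberTheory.Rogawski1990 Literature.NumberTheory.Automorphic Literature.NumberTheory.Automorphic.UnitaryGroup Literature.RepresentationTheory
open Summit.HodgeConjecture.HodgeConjecture.Cruxes.H413

namespace Summit.HodgeConjecture.HodgeConjecture.Cruxes.H413.F0P3cStCharTSLdsSelfExtSplit

variable (L : Type) [Field L] [NumberField L] [IsCMField L] (v : HeightOneSpectrum (𝓞 ↥(maximalRealSubfield L)))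

/-- The line of a `ℂˣ`-valued character as a representation: `(𝟙 ⊗ θ) m x = θ(m) · x` (★ `Representation.twist_apply`). [cite: BernsteinZelevinsky1977, §2.3] -/
theorem twist_trivial_apply {M : Type*} [Group M] (θ : M →* ℂˣ) (m : M) (x : ℂ) :
    ((Representation.trivial ℂ M ℂ).twist θ) m x = ((Units.coeHom ℂ).comp θ) m * x := by
  simp [Representation.twist_apply]

set_option synthInstance.maxHeartbeats 400000 in
set_option maxHeartbeats 20000000 in  -- ONE call of the abstract half at the CM carrier (`cmPrincipalSeries = normalizedInd … (𝟙 ⊗ θ̃)` by δ; 64-B∕64-C budget class)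
/-- **E1 ROW 68-H — K4′ SPLIT @ DATUM.**  At a finite place `v` of `L⁺` non-split in `L`, for continuous `χ₁, χ₂` with `χ₁` trivial on the `σ`-fixed units (case (3)) and two distinct
constituents of `I₀ = i_G(χ₁, χ₂)` (`htwo`): GIVEN the open-cell jet datum of every additive character of the torus with open kernel (`hGLd`, (M5)) — the additive line `hrank` being ★ 68-R at any
place `w ∣ v` — EVERY SMOOTH SELF-EXTENSION of a representative `r` of ANY constituent `c` of `I₀` SPLITS — the `hsplit` binder of ★ 59 trunk `innerG_char_self_eq_one_of_isPseudoCoeff_epThree`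
VERBATIM at `r`. [cite: Rogawski1990, §12.2 (3) pp. 173–174] [cite: Keys1984, §3 pp. 118–119; §4 Thm. 3 p. 120] [cite: Casselman1995, §7.1, Cor. 6.3.9 (b)] [cite: BernsteinZelevinsky1977, §2.3] -/
theorem forall_smooth_selfExtension_split_of_mem_lds (hns : ∀ w : PlacesOver L v, IsCMField.complexConj L • w.1 = w.1)
    (χ₁ : (LocalRing L v)ˣ →* ℂˣ) (χ₂ : ↥(normOneUnits (conjLocal L (IsCMField.complexConj L) v)) →* ℂˣ)
    (hc1 : Continuous (fun x => ((χ₁ x : ℂˣ) : ℂ))) (hc2 : Continuous (fun x => ((χ₂ x : ℂˣ) : ℂ)))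
    (htriv : ∀ a : (LocalRing L v)ˣ, (conjLocal L (IsCMField.complexConj L) v) (a : LocalRing L v) = a → χ₁ a = 1)
    (htwo : ∃ c₁ c₂ : IrrClass (Gqs L v), c₁ ≠ c₂ ∧ c₁.IsConstituentOf (cmPrincipalSeries L 3 v (cmTorusCharPair L v χ₁ χ₂)) ∧
      c₂.IsConstituentOf (cmPrincipalSeries L 3 v (cmTorusCharPair L v χ₁ χ₂)))
    (hGLd : haveI := locallyCompactSpace_cmBorelU L 3 v
      ∀ (lam : ↥(cmBorelTriple L 3 v).M → ℂ), lam 1 = 0 → (∀ m m' : ↥(cmBorelTriple L 3 v).M, lam (m * m') = lam m + lam m') →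
      (∃ U : Subgroup ↥(cmBorelTriple L 3 v).M, IsOpen (U : Set ↥(cmBorelTriple L 3 v).M) ∧ ∀ m ∈ U, lam m = 0) →
      ∃ (N₀ N₀' : Representation ℂ ↥(cmBorelTriple L 3 v).M (ℂ × ℂ))
        (ℓ : Submodule ℂ ((cmBorelTriple L 3 v).restrict (Representation.normalizedInd (cmBorelTriple L 3 v) N₀)).Coinvariants) (θ : ↥ℓ ≃ₗ[ℂ] (ℂ × ℂ)),
        (∀ (m : ↥(cmBorelTriple L 3 v).M) (w : ℂ × ℂ), N₀ m w =
          (((Representation.trivial ℂ ↥(cmBorelTriple L 3 v).M ℂ).twist (cmTorusCharPair L v χ₁ χ₂)) m w.1,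
            lam m • ((Representation.trivial ℂ ↥(cmBorelTriple L 3 v).M ℂ).twist (cmTorusCharPair L v χ₁ χ₂)) m w.1 +
              ((Representation.trivial ℂ ↥(cmBorelTriple L 3 v).M ℂ).twist (cmTorusCharPair L v χ₁ χ₂)) m w.2)) ∧
        (∀ (m : ↥(cmBorelTriple L 3 v).M) (w : ℂ × ℂ), N₀' m w =
          (((Representation.trivial ℂ ↥(cmBorelTriple L 3 v).M ℂ).twist (cmTorusCharPair L v χ₁ χ₂)) m w.1,
            (-lam m) • ((Representation.trivial ℂ ↥(cmBorelTriple L 3 v).M ℂ).twist (cmTorusCharPair L v χ₁ χ₂)) m w.1 +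
              ((Representation.trivial ℂ ↥(cmBorelTriple L 3 v).M ℂ).twist (cmTorusCharPair L v χ₁ χ₂)) m w.2)) ∧
        (∀ x, x ∈ ℓ ↔ ∃ f : Representation.SmoothInd (cmBorelTriple L 3 v).P (Representation.twist (N₀.comp (cmBorelTriple L 3 v).proj) (rootDeltaChar (cmBorelTriple L 3 v).P)),
          f.toFun 1 = 0 ∧ Representation.Coinvariants.mk ((cmBorelTriple L 3 v).restrict (Representation.normalizedInd (cmBorelTriple L 3 v) N₀)) f = x) ∧
        (∀ (m : ↥(cmBorelTriple L 3 v).M) (x : ((cmBorelTriple L 3 v).restrict (Representation.normalizedInd (cmBorelTriple L 3 v) N₀)).Coinvariants) (hx : x ∈ ℓ)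
          (hmx : (Representation.normalizedInd (cmBorelTriple L 3 v) N₀).normalizedJacquet (cmBorelTriple L 3 v) m x ∈ ℓ),
          θ ⟨(Representation.normalizedInd (cmBorelTriple L 3 v) N₀).normalizedJacquet (cmBorelTriple L 3 v) m x, hmx⟩ = N₀' m (θ ⟨x, hx⟩)) ∧
        (∀ (S : (Representation.normalizedInd (cmBorelTriple L 3 v) N₀).IntertwiningMap (Representation.normalizedInd (cmBorelTriple L 3 v) N₀)),
          (∀ (F : Representation.SmoothInd (cmBorelTriple L 3 v).P (Representation.twist (N₀.comp (cmBorelTriple L 3 v).proj) (rootDeltaChar (cmBorelTriple L 3 v).P)))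
            (x : Gqs L v), (S F).toFun x = (0, (F.toFun x).1)) →
          ∀ (x : ((cmBorelTriple L 3 v).restrict (Representation.normalizedInd (cmBorelTriple L 3 v) N₀)).Coinvariants) (hx : x ∈ ℓ) (hSx : Representation.jacquetMap (cmBorelTriple L 3 v) S x ∈ ℓ),
            θ ⟨Representation.jacquetMap (cmBorelTriple L 3 v) S x, hSx⟩ = (0, (θ ⟨x, hx⟩).1)))
    (c : IrrClass (Gqs L v)) (hc : c.IsConstituentOf (cmPrincipalSeries L 3 v (cmTorusCharPair L v χ₁ χ₂)))
    (r : SmoothIrrep (Gqs L v)) (hr : IrrClass.mk r = c) :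
    ∀ (E : Type) [AddCommGroup E] [Module ℂ E] (ρE : Representation ℂ (Gqs L v) E), ρE.IsSmooth →
      ∀ (i : r.ρ.IntertwiningMap ρE) (p : ρE.IntertwiningMap r.ρ), Function.Injective i → LinearMap.ker p.toLinearMap = LinearMap.range i.toLinearMap →
        Function.Surjective p → ∃ s : r.ρ.IntertwiningMap ρE, p.comp s = Representation.IntertwiningMap.id r.ρ := by
  haveI := locallyCompactSpace_cmBorelU L 3 v
  -- ★ 68-A DATUM for `c`: the realised member `A` and its partner class `c′`
  have H := F0P3cStCharTSLdsRealisationBoth.exists_ldsRealisation_schurPair_of_mem L v hns χ₁ χ₂ hc1 hc2 htriv htwo c hc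
  cases H with
  | intro c' H =>
  cases H with
  | intro hne H =>
  cases H with
  | intro hJH H =>
  cases H with
  | intro A H =>
  cases H with
  | intro hAinv H =>
  cases H with
  | intro hAirr H =>
  cases H with
  | intro hHom0 H =>
  cases H with
  | intro hSchur H =>
  cases H with
  | intro hsub H =>
  cases H with
  | intro hquot hNT =>
  cases hsub with
  | intro hirrA hsub =>
  cases hsub with
  | intro hsmA hlabA =>
  -- ★ 68-A DATUM for the partner `c′`: the second member `A′`
  have hc' : c'.IsConstituentOf (cmPrincipalSeries L 3 v (cmTorusCharPair L v χ₁ χ₂)) := (hJH c').2 (Or.inl rfl)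
  have H' := F0P3cStCharTSLdsRealisationBoth.exists_ldsRealisation_schurPair_of_mem L v hns χ₁ χ₂ hc1 hc2 htriv htwo c' hc'
  cases H' with
  | intro c'' H' =>
  cases H' with
  | intro hne' H' =>
  cases H' with
  | intro hJH' H' =>
  cases H' with
  | intro A' H' =>
  cases H' with
  | intro hA'inv H' =>
  cases H' with
  | intro hA'irr H' =>
  cases H' with
  | intro hHom0' H' =>
  cases H' with
  | intro hSchur' H' =>
  cases H' with
  | intro hsub' H' =>
  cases H' with
  | intro hquot' hNT' =>
  cases hsub' with
  | intro hirrA' hsub' =>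
  cases hsub' with
  | intro hsmA' hlabA' =>
  -- the two members are inequivalent (`c ≠ c′`) and distinct as submodules
  have hneq : ∀ e : ((Representation.normalizedInd (cmBorelTriple L 3 v) ((Representation.trivial ℂ ↥(cmBorelTriple L 3 v).M ℂ).twist (cmTorusCharPair L v χ₁ χ₂))).subrepresentation A hAinv).Equiv
      ((Representation.normalizedInd (cmBorelTriple L 3 v) ((Representation.trivial ℂ ↥(cmBorelTriple L 3 v).M ℂ).twist (cmTorusCharPair L v χ₁ χ₂))).subrepresentation A' hA'inv), False := by
    intro e
    have h := IrrClass.mk_eq_mk_of_equiv (r₁ := ⟨↥A, _, hirrA, hsmA⟩) (r₂ := ⟨↥A', _, hirrA', hsmA'⟩) e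
    rw [hlabA, hlabA'] at h
    exact hne h.symm
  have hAA' : A ≠ A' := by
    intro h
    subst h
    exact hneq (Representation.Equiv.refl _)
  -- the datum letters
  obtain ⟨K, hKo, hKc⟩ := F0P3bCentralCharacterUnitaryNonsplit.exists_isOpen_isCompact_subgroup_cmLocal L 3 v
  have hadm := F0P3XiUnramNonsplitInstance.isAdmissible_cmPrincipalSeries L v (cmTorusCharPair L v χ₁ χ₂)
  have hlen := F0P3U3PrincipalSeriesLettersHold.u3PrincipalSeriesLengthLeTwo_holds L v hns χ₁ χ₂ hc1 hc2
  have h1 := F0P3U3PrincipalSeriesJacquetFiltrationHolds.U3PrincipalSeriesJacquetFiltration_holds L v hns χ₁ χ₂ hc1 hc2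
  cases h1 with
  | intro hfd hrest =>
  cases hrest with
  | intro h2 _ =>
  have hχL : ∀ (m : ↥(cmBorelTriple L 3 v).M) (x : ℂ), ((Representation.trivial ℂ ↥(cmBorelTriple L 3 v).M ℂ).twist (cmTorusCharPair L v χ₁ χ₂)) m x =
      ((Units.coeHom ℂ).comp (cmTorusCharPair L v χ₁ χ₂)) m * x := twist_trivial_apply (cmTorusCharPair L v χ₁ χ₂)
  have hχ : ∀ m, IsUnit (((Units.coeHom ℂ).comp (cmTorusCharPair L v χ₁ χ₂)) m) := fun m => Units.isUnit _
  -- the open kernel of an occurring additive character: `T ∩ K_v` (★ 40‴β §1∕§2)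
  have hKv := isCompact_isOpen_cmLocalIntegralLevel L 3 (Matrix.of fun i j : Fin 3 => if i.val + j.val + 1 = 3 then (1 : L) else 0) v
  -- ONE application of the abstract half at the datum, then transport to the representative `r` (★ 63-D)
  haveI : FiniteDimensional ℂ ((cmBorelTriple L 3 v).restrict (Representation.normalizedInd (cmBorelTriple L 3 v)
      ((Representation.trivial ℂ ↥(cmBorelTriple L 3 v).M ℂ).twist (cmTorusCharPair L v χ₁ χ₂)))).Coinvariants := hfd
  -- ★ 68-R «`hrank` AT THE DATUM» (the locally-zero additive characters of `T(L⁺_v)` form one line), at any place `w ∣ v` (all are `c`-fixed by `hns`)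
  obtain ⟨w⟩ : Nonempty (PlacesOver L v) := inferInstance
  have hrank68R : ∀ (lam : ↥(cmBorelTriple L 3 v).M → ℂ), lam 1 = 0 → (∀ m m' : ↥(cmBorelTriple L 3 v).M, lam (m * m') = lam m + lam m') →
      (∃ U : Subgroup ↥(cmBorelTriple L 3 v).M, IsOpen (U : Set ↥(cmBorelTriple L 3 v).M) ∧ ∀ m ∈ U, lam m = 0) → (∃ m, lam m ≠ 0) →
      ∀ β : ↥(cmBorelTriple L 3 v).M → ℂ, (∀ m m', β (m * m') = β m + β m') →
        (∃ U : Subgroup ↥(cmBorelTriple L 3 v).M, IsOpen (U : Set ↥(cmBorelTriple L 3 v).M) ∧ ∀ m ∈ U, β m = 0) → ∃ c : ℂ, ∀ m, β m = c * lam m :=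
    fun lam _ hlam hop hne => by
      obtain ⟨U, hUo, hU⟩ := hop
      exact F0P3cStCharTSAdditiveCharLine.additive_eq_mul_of_eq_zero_on_open L v w (hns w) lam hlam U hUo hU hne
  have habs := F0P3cStCharTSLdsSelfExtSplitAbs.forall_smooth_selfExtension_split_of_realisedPair (cmBorelTriple L 3 v)
    (F0P2nBorelCharactersUnipotent.deltaChar_cmBorel_eq_one L v) (F0P3UnipotentLimitCompactOpen.isLimitOfCompactOpen_cmUnipotentU L v)
    ((Units.coeHom ℂ).comp (cmTorusCharPair L v χ₁ χ₂)) ((Representation.trivial ℂ ↥(cmBorelTriple L 3 v).M ℂ).twist (cmTorusCharPair L v χ₁ χ₂)) hχL hχ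
    hadm hKo hKc h2 hlen A hAinv hAirr hHom0 hSchur hirrA hNT A' hA'inv hA'irr hirrA' hNT' hneq hAA'
    (fun X _ _ τ hτ pJ u₀ e hu₀ he hfree lam hlam1 hlam hne0 hocc =>
      F0P3cStCharTSHeightOracleAtDatum.exists_height_of_occurring L 3 v τ hτ _ pJ hu₀ he hfree lam hlam hocc)
    (fun X _ _ τ hτ pJ u₀ e hu₀ he hfree lam hlam hocc =>
      ⟨(cmLocalIntegralLevel L 3 (Matrix.of fun i j : Fin 3 => if i.val + j.val + 1 = 3 then (1 : L) else 0) v).comap (cmBorelTriple L 3 v).M.subtype,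
        (hKv.2.preimage continuous_subtype_val), fun s hs =>
          F0P3cStCharTSHeightOracleAtDatum.additive_eq_zero_on_level_of_occurring L 3 v τ hτ _ pJ hu₀ he hfree lam hlam hocc s hs⟩)
    hGLd hrank68R
  -- transport along `I₀|_A ≃ r` (the class of `A` is `c = ⟦r⟧`)
  have hcl : IrrClass.mk ⟨↥A, _, hirrA, hsmA⟩ = IrrClass.mk r := hlabA.trans hr.symm
  cases (IrrClass.mk_eq_mk_iff _ _).1 hcl with
  | intro e =>
  intro E _ _ ρE hE i p hi hex hp
  exact forall_smooth_selfExtension_split_of_equiv e habs E ρE hE i p hi hex hp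

end Summit.HodgeConjecture.HodgeConjecture.Cruxes.H413.F0P3cStCharTSLdsSelfExtSplit

end
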